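import Summits.BirchSwinnertonDyer.BirchSwinnertonDyer.Theorems.UniversalToricDescentDefectTransportNoLocalHypothesis
import Summits.BirchSwinnertonDyer.BirchSwinnertonDyer.Theorems.UniversalToricDescentTwinLocalTowerTorsionFinite
import Summits.BirchSwinnertonDyer.BirchSwinnertonDyer.Theorems.EisensteinPrimesBSDpOnCellCCtlLocFinV
import Summits.BirchSwinnertonDyer.Rank1Residual.Additive.OrdinaryThreeCriteria
import Summits.BirchSwinnertonDyer.Rank1Residual.X11b.Three.ControlIdentityOdd
import Literature.NumberTheory.EllipticCurves.LocalTorsionMultiplicativeProofs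
import HarnessLib

/-!
# Fin_v for every NON-ADDITIVE twin at `3`, and stub B′ of ♭T′ modulo the twin's base finiteness ALONE
# (route `UniversalToricDescent`, crux ♭T′ stmt-BirchSwinnertonDyer-26975 `DefectTransportModThreePT`, line
# `sigmacongruence`; seat `bsd-wall-utd-p1` gen 13)

`…DefectTransportNoLocalHypothesis` (`defectTransport_algebraicHalf_lambda_of_wall_of_twinBaseFinite`) gives stub B′
(`stub_lambdaTransportPT`: Greenberg–Vatsal's λ-transport for `X_{∅,0}` along `E[3] ≅ E′[3]`, hypothesis (iv) retired)
from B′'s binders plus two residues: (R1) the twin's base finiteness `Sel_v(K, E′[3^∞]) < ∞` at `v ∣ 3` and (R2) the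
twin's local tower torsion finiteness `LocalTowerTorsionFiniteAt (E′_K) 3 κ 𝔭′`.  This file DISCHARGES (R2) for every
twin with `¬ Addv W′ 3` (a binder of ♭T′), by reduction type at `3`:

* good ordinary (incl. anomalous) — `…TwinLocalTowerTorsionFinite.localTowerTorsionFiniteAt_baseChange_of_goodOrdinary`
  (this seat: the norm residue symbol of `π²/3^h` on Greenberg's line and on the étale quotient);
* good supersingular — `localTowerTorsionFiniteAt_of_potentiallySupersingular` on Serre's Prop. 8
  (`noStableDivisibleLine_of_potentiallySupersingular_holds`), fed by `3 ∣ a₃ ⟺ (j = 0 ∨ ord₃ j > 0)`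
  (`goodSS_three_iff_j`) and Deuring (`not_hasUnitRootAt_baseChange_three_of_padicValRat_j`);
* split multiplicative — `CtlLoc.localTowerTorsionFiniteAt_of_hasSplitMultiplicativeReductionAtPrime` (Tate line);
* non-split multiplicative — `E′(ℚ₃)[3] = 0` (`LocalTorsionMult.localTorsion_eq_zero_of_nonsplit`), so the tower torsion
  VANISHES (`AcSelmer.fixedPoints_decomp_inf_kerSubgroup_eq_bot_of_noPTorsion`, pro-`3` descent).

* §1 `localTowerTorsionFiniteAt_baseChange_three_of_not_addv` — (R2) for every non-additive twin;
* §2 **`defectTransport_algebraicHalf_lambda_of_wall_of_twinBaseFinite_of_not_addv`** — stub B′'s conclusion VERBATIM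
  from B′'s binders + (R1) alone.  So the algebraic half of ♭T′ is closed modulo exactly the TWIN's base finiteness at
  `v ∣ 3` (⟸ `y_K(E′)` non-torsion; false for twins of `K`-rank ≥ 2 — Greenberg–Vatsal Prop. 2.1/2.5 over the tower would
  be needed there) — and, for the crux, the research stub A (`SigmaCongruenceAtThree`).

THEOREMS ONLY; no definition, no named fact, no `sorry`; conditional on the cited Poitou–Tate facts (binders of ♭T′).
BSD is not advanced by this file.  References: [GreenbergVatsal2000] Thm. (1.4), §2; [GreenbergLNM1716] §2 p. 70, §3;
[JetchevSkinnerWan2017] §3.3 Prop. 3.3.4; [Serre1967GroupesPDivisibles] §5 Prop. 8; [SilvermanAEC2009] VII.6.1.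
-/

set_option autoImplicit false
-- `…BirchSwinnertonDyer.BirchSwinnertonDyer.Theorems…` is the problem's mandated namespace (D-0017).
set_option linter.dupNamespace false

noncomputable section

open scoped Classical

namespace Summit.BirchSwinnertonDyer.BirchSwinnertonDyer.Theorems.UniversalToricDescentDefectTransport

open Function Field NumberField IsDedekindDomain WeierstrassCurve
open Literature.NumberTheory.GaloisRepresentations Literature.NumberTheory.EllipticCurves
  Literature.NumberTheory.EllipticCurves.GreenbergSelmer Literature.NumberTheory.GaloisCohomology
  Literature.NumberTheory.EllipticCurves.IwasawaAlgebra Literature.NumberTheory.EllipticCurves.Rank1Residual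
  Summit.BirchSwinnertonDyer.Rank1Residual Summit.BirchSwinnertonDyer.Rank1Residual.X11b
  Summit.BirchSwinnertonDyer.Rank1Residual.X11b.AcSelmer Summit.BirchSwinnertonDyer.Rank1Residual.Iwasawa
  Summit.BirchSwinnertonDyer.Rank1Residual.X11b.Coinv Summit.BirchSwinnertonDyer.Rank1Residual.X11b.LocBridge
  Summit.BirchSwinnertonDyer.BirchSwinnertonDyer.Theorems.UniversalToricDescentSigmaPassage
  Summit.BirchSwinnertonDyer.BirchSwinnertonDyer.Theorems.UniversalToricDescentSigmaLocalImage
  Summit.BirchSwinnertonDyer.BirchSwinnertonDyer.Theorems.UniversalToricDescentSigmaCoinvariants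
  Summit.BirchSwinnertonDyer.Rank1Residual.Additive
  Summit.Ventures.HodgeRepro2.T5DegreeOneNumberField
  Summit.BirchSwinnertonDyer.BirchSwinnertonDyer.Theorems.SchneiderFreeControlAtoms
  Summit.BirchSwinnertonDyer.BirchSwinnertonDyer.Theorems.PotentiallySupersingularLocalTorsion
  Summit.BirchSwinnertonDyer.BirchSwinnertonDyer.Theorems.UniversalToricDescentTwinLocalTower

/-! ### §1 Fin_v for every non-additive twin at `3` -/

/-- **(R2) for every non-additive `E′/ℚ` at `3`.**  `E′` globally minimal with good or multiplicative reduction at `3`,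
`K` imaginary quadratic with `3` split, `κ` anticyclotomic, `𝔭 ∣ 3`: `E′(K̄)[3^∞]^{D_𝔭 ⊓ Gal(K̄/K_∞)}` is finite.  By
reduction type: good ordinary (`localTowerTorsionFiniteAt_baseChange_of_goodOrdinary`), good supersingular (Serre
Prop. 8 road, `3 ∣ a₃ ⟺ 3 ∣ j`), split multiplicative (Tate line, `CtlLoc`), non-split multiplicative (`E′(ℚ₃)[3] = 0`,
pro-`3` descent). [cite: JetchevSkinnerWan2017, §3.3 Prop. 3.3.4 (arXiv:1512.06894 p. 13)]
[cite: Serre1967GroupesPDivisibles, §5 Prop. 8] [cite: SilvermanAEC2009, Thm. VII.6.1] -/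
theorem localTowerTorsionFiniteAt_baseChange_three_of_not_addv (W' : WeierstrassCurve ℚ) [W'.IsElliptic]
    [W'.IsGloballyMinimal] (hadd : ¬ Addv W' 3) {K : Type} [Field K] [NumberField K]
    (hK : IsImaginaryQuadratic K) (hsplit : SplitsIn K 3) (κ : ZpExtension K 3) (hκ : κ.IsAnticyclotomic)
    (𝔭 : HeightOneSpectrum (𝓞 K)) (h𝔭 : ((3 : ℕ) : 𝓞 K) ∈ 𝔭.asIdeal) :
    LocalTowerTorsionFiniteAt (W'.baseChange K) 3 κ 𝔭 := by
  obtain ⟨he, hf⟩ := degreeOne_of_splitsIn hK.1 hsplit h𝔭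
  by_cases hgood : W'.HasGoodReductionAtPrime 3
  · have hΔ : ¬ (3 : ℤ) ∣ minimalDiscriminantInt W' := fun h ↦
      not_hasGoodReductionAtPrime_of_dvd_minimalDiscriminantInt W' 3 (by exact_mod_cast h) hgood
    by_cases hord : ((3 : ℕ) : ℤ) ∣ W'.frobeniusTrace 3
    · -- good supersingular: `3 ∣ j` (or `j = 0`), Deuring, Serre Prop. 8
      have hj : W'.j = 0 ∨ 0 < padicValRat 3 W'.j := ((goodSS_three_iff_j W').mp ⟨hgood, hord⟩).2
      set u₃ : HeightOneSpectrum (𝓞 ℚ) :=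
        (Rat.HeightOneSpectrum.primesEquiv (R := 𝓞 ℚ)).symm ⟨3, Nat.prime_three⟩ with hu₃def
      have hu₃ : ((3 : ℕ) : 𝓞 ℚ) ∈ u₃.asIdeal :=
        (natCast_mem_asIdeal_iff_eq_primesEquiv_symm u₃ Nat.prime_three).mpr rfl
      have hgoodAt : (W'.baseChange ℚ).HasGoodReductionAt u₃ := by
        rw [show W'.baseChange ℚ = W' from W'.map_id]
        exact hasGoodReductionAt_of_hasGoodReductionAtPrime 3 W' hgood
      have hnn : 0 ≤ padicValRat 3 W'.j :=
        padicValRat_j_nonneg_of_hasGoodReductionAt_baseChange W' 3 hu₃ hgoodAt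
      exact localTowerTorsionFiniteAt_of_potentiallySupersingular
        Serre1967.noStableDivisibleLine_of_potentiallySupersingular_holds W' 3 (by decide) hnn
        (fun F _ _ w hw hgoodw ↦ not_hasUnitRootAt_baseChange_three_of_padicValRat_j W' hj hw hgoodw)
        K κ 𝔭 h𝔭 he hf
    · -- good ordinary (this seat)
      exact localTowerTorsionFiniteAt_baseChange_of_goodOrdinary W' (by decide) hΔ (by exact_mod_cast hord)
        hK hsplit κ hκ 𝔭 h𝔭
  · have hmult : W'.HasMultiplicativeReductionAtPrime 3 := by
      by_contra h
      exact hadd ⟨hgood, h⟩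
    by_cases hsplitW : W'.HasSplitMultiplicativeReductionAtPrime 3
    · -- split multiplicative: the Tate line
      exact CtlLoc.localTowerTorsionFiniteAt_of_hasSplitMultiplicativeReductionAtPrime W' (by decide) hsplitW
        hK hsplit κ hκ 𝔭 h𝔭
    · -- non-split multiplicative: `E′(ℚ₃)[3] = 0`, the tower torsion vanishes
      have h4 : ∀ R : (W'.baseChange ℚ_[3]).toAffine.Point, 3 • R = 0 → R = 0 :=
        LocalTorsionMult.localTorsion_eq_zero_of_nonsplit W' 3 le_rfl hmult hsplitW
      unfold LocalTowerTorsionFiniteAt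
      rw [AcSelmer.fixedPoints_decomp_inf_kerSubgroup_eq_bot_of_noPTorsion W' 3 h4 K κ 𝔭 h𝔭 he hf]
      exact (Set.finite_singleton (0 : (W'.baseChange K).geomPrimaryTorsion 3)).subset
        fun x hx ↦ by simpa using hx

/-! ### §2 Stub B′ from its binders and the twin's base finiteness alone -/

/-- **Stub B′ (`stub_lambdaTransportPT`, line `sigmacongruence` of ♭T′) WITHOUT (iv) and WITHOUT the twin's local
tower torsion hypothesis.**  Conclusion = B′'s conclusion VERBATIM; hypotheses = B′'s binders (the wall regime of the
wild curve, the congruent non-additive twin, the Heegner field, the anticyclotomic branch, Poitou–Tate ×2, the wild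
curve's base finiteness at `v ∣ 3`) + ONE residue: the twin's base finiteness `Sel_v(K, E′[3^∞]) < ∞` at `v ∣ 3`
(R1).  (R2) is discharged by §1 from the binder `¬ Addv W′ 3`.
[cite: GreenbergVatsal2000, Thm. (1.4), §2 Prop. (2.1), (2.8)] [cite: GreenbergLNM1716, §3 Lemma 3.3, §2 p. 70] -/
theorem defectTransport_algebraicHalf_lambda_of_wall_of_twinBaseFinite_of_not_addv (W W' : WeierstrassCurve ℚ)
    [W.IsElliptic] [W.IsGloballyMinimal] [W'.IsElliptic] [W'.IsGloballyMinimal] {N N' : ℕ} (K : Type) [Field K]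
    [NumberField K]
    (hO6 : Additive.ClassO6 W 3) (hsurj : W.HasSurjectiveModNGaloisRep 3) (hN : W.conductorNorm ℤ = N)
    (hcong : O6.ModPCongruent W' W 3) (hadd' : ¬ Addv W' 3) (hN' : W'.conductorNorm ℤ = N')
    (hK : IsImaginaryQuadratic K)
    (hHe : SatisfiesHeegnerHypothesis N K) (hHe' : SatisfiesHeegnerHypothesis N' K)
    (κ : ZpExtension K 3) (hκ : κ.IsAnticyclotomic) (γ : absoluteGaloisGroup K)
    [Fact (κ.IsTopGenerator γ)] {𝔭' : HeightOneSpectrum (𝓞 K)} (h𝔭' : ((3 : ℕ) : 𝓞 K) ∈ 𝔭'.asIdeal)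
    (hT : Module.IsTorsion (IwasawaAlgebra 3) (XAc (W.baseChange K) 3 κ 𝔭' ∅ γ))
    {L : UnrSeries 3}
    (hle : Ideal.span {L} ≤
      (XAc.charIdeal (W.baseChange K) 3 κ 𝔭' ∅ γ).map (PowerSeries.map (Halves.toUnr 3)))
    (hi : ∃ i : ℕ, ‖((PowerSeries.coeff i L : unrIntegers 3) : ℂ_[3])‖ = 1)
    (hPT : poitouTate_selmerStructure_duality K) (hPT2 : poitouTate_sha_tateDual K)
    (hfin : ∀ v : HeightOneSpectrum (𝓞 K), ((3 : ℕ) : 𝓞 K) ∈ v.asIdeal →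
      Finite (selmerAcBase (W.baseChange K) 3 v ∅))
    (hfin' : ∀ v : HeightOneSpectrum (𝓞 K), ((3 : ℕ) : 𝓞 K) ∈ v.asIdeal →
      Finite (selmerAcBase (W'.baseChange K) 3 v ∅)) :
    ∃ (T : Finset (HeightOneSpectrum (𝓞 K))) (c s s' : HeightOneSpectrum (𝓞 K) → ℕ),
      (↑T = {v : HeightOneSpectrum (𝓞 K) | ((3 : ℕ) : 𝓞 K) ∉ v.asIdeal ∧
        (¬ (W.baseChange K).HasGoodReductionAt v ∨ ¬ (W'.baseChange K).HasGoodReductionAt v)}) ∧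
      (∀ v ∈ T, (∃ d₀ : decomp (K := K) v, (κ (d₀ : absoluteGaloisGroup K)).toAdd = (3 : ℤ_[3]) ^ c v) ∧
        (∀ d : decomp (K := K) v, (3 : ℤ_[3]) ^ c v ∣ (κ (d : absoluteGaloisGroup K)).toAdd) ∧
        Nat.card {f : subgroupH1 (kerD κ v) ((W.baseChange K).geomPrimaryTorsion 3) // 3 • f = 0} =
          3 ^ s v ∧
        Nat.card {f : subgroupH1 (kerD κ v) ((W'.baseChange K).geomPrimaryTorsion 3) // 3 • f = 0} =
          3 ^ s' v) ∧
      (∃ g : UnrSeries 3,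
        (XAc.charIdeal (W.baseChange K) 3 κ 𝔭' ∅ γ).map (PowerSeries.map (Halves.toUnr 3)) =
            Ideal.span {g} ∧
          (∀ i < lambdaInvariant 3 (XAc (W.baseChange K) 3 κ 𝔭' ∅ γ),
            ‖((PowerSeries.coeff i g : unrIntegers 3) : ℂ_[3])‖ < 1) ∧
          ‖((PowerSeries.coeff (lambdaInvariant 3 (XAc (W.baseChange K) 3 κ 𝔭' ∅ γ)) g :
            unrIntegers 3) : ℂ_[3])‖ = 1) ∧
      Module.IsTorsion (IwasawaAlgebra 3) (XAc (W'.baseChange K) 3 κ 𝔭' ∅ γ) ∧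
      (∃ g' : UnrSeries 3,
        (XAc.charIdeal (W'.baseChange K) 3 κ 𝔭' ∅ γ).map (PowerSeries.map (Halves.toUnr 3)) =
            Ideal.span {g'} ∧
          (∀ i < lambdaInvariant 3 (XAc (W'.baseChange K) 3 κ 𝔭' ∅ γ),
            ‖((PowerSeries.coeff i g' : unrIntegers 3) : ℂ_[3])‖ < 1) ∧
          ‖((PowerSeries.coeff (lambdaInvariant 3 (XAc (W'.baseChange K) 3 κ 𝔭' ∅ γ)) g' :
            unrIntegers 3) : ℂ_[3])‖ = 1) ∧
      lambdaInvariant 3 (XAc (W.baseChange K) 3 κ 𝔭' ∅ γ) + ∑ v ∈ T, 3 ^ c v * s v =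
        lambdaInvariant 3 (XAc (W'.baseChange K) 3 κ 𝔭' ∅ γ) + ∑ v ∈ T, 3 ^ c v * s' v := by
  -- `3` splits in the Heegner field (`3 ∣ N`: the wild curve is additive at `3`)
  have hadd : Addv W 3 := hO6.2.1
  have hpN : 3 ∣ W.conductorNorm ℤ := (W.dvd_conductorNorm_iff_not_hasGoodReductionAtPrime 3).mpr hadd.1
  have hsplit : SplitsIn K 3 := hHe 3 (Fact.out) (hN ▸ hpN)
  -- (R2) for the twin, then the (iv)-free transport
  have hδ' : LocalTowerTorsionFiniteAt (W'.baseChange K) 3 κ 𝔭' :=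
    localTowerTorsionFiniteAt_baseChange_three_of_not_addv W' hadd' hK hsplit κ hκ 𝔭' h𝔭'
  exact defectTransport_algebraicHalf_lambda_of_wall_of_twinBaseFinite W W' K hO6 hsurj hN hcong hN' hK hHe hHe'
    κ hκ γ h𝔭' hT hle hi hPT hPT2 hfin hfin' hδ'

end Summit.BirchSwinnertonDyer.BirchSwinnertonDyer.Theorems.UniversalToricDescentDefectTransport

end
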